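import Summits.QuantumFields.YangMills.Theorems.BalabanUVNodesK0RecordFormatNamesLemmas9
import Summits.QuantumFields.YangMills.Theorems.BalabanUVNodesPortU8RootedGaugeSeam
import Literature.MathematicalPhysics.QuantumFieldTheory.Balaban1983to89.B5Eq147TorusBridge
import Literature.MathematicalPhysics.QuantumFieldTheory.Balaban1983to89.B6SectAWholeTorusBridge

/-!
# PORT PT-B (U8), g2 file 9 — THE TokP9L4 BRIDGE (port-lead O-5, CRIT-1 RULING (P)→(α)): (i) the `(k+1)`-fold «`Q′*`-RANGE» lemma — a site function is ORTHOGONAL TO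
# `N(Q′_j) = ker Q′_j` iff it is BLOCK-CONSTANT (a pullback along `coarsenTo j = blockIter j`); (ii) a bond field in the (21)-Landau subspace `lan` has `Δ∂*`
# block-constant ([B5] p.25 «R is an orthogonal projection on ΔN(Q′_k)»); (iii) `tokP9L4_old_of_new`: 27931 v9-L's TokP9L4‴ token (the four (190)-clauses ON
# `recordHr`) IMPLIES the old TokP9L4 token of 27930∕26648 (`∃ Hr φ, D = Hr + dφ ∧ (21)-LR ∧` the four clauses) — per point and as whole tokens — so the K0ᴬ JOIN can carry
# v9-L's antecedent list and feed the old block ONCE — `--supports stmt-QuantumFields-27931` (helper; antecedent-side bookkeeping; NOT a closer)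

Cell `ym-nodeO-ideate` ∕ `ym-balaban-port`, porter `ymgap-nodeO-port-PTB-1` (gen 2); item **stmt-QuantumFields-27931** `BalabanUVNodes.PortPieceLocalityU8` (v9-L ce176c419bf63055).
[B5] = [Balaban1984PropagatorsI], [B6] = [Balaban1984PropagatorsII], [15] = [Balaban1985Variational].
WHAT IS PROVED (0 `sorry`, 0 `def`; standard axioms): §1 `coarsenTo_eq_blockIter`; §2 `siteAvgIter_blockConst` (block-constant functions average to themselves),
`sum_fiber_blockIter` (the `j`-block sum is `(L^d)^j ·` the iterated average); §3 ★ `mem_orthogonal_ker_Qp_iff` — `f ∈ (ker (opsV1 P j c s).Qp)ᗮ ↔ ∃ g, ∀ x, f x = g (blockIter j x)`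
(CRIT-1's statement; also with `coarsenTo`); §4 ★ `lap_dstar_blockConst_of_mem_lan` — `A ∈ lan P j c s ⇒ ∃ g, Δ∂*A = g ∘ blockIter j` (via `B5Eq147TorusBridge.projR_eq_zero_iff`, symmetry
of `Δ = ∂*∂`); at `c = s = 1` and entrywise-complex: `laplace_diverg_blockConst_of_mem_lan`; §5 ★★ `tokP9L4_old_of_new_at` ∕ `tokP9L4_old_of_new` — the per-point and the
whole-token bridges, token bodies VERBATIM (v9-L ce176c41 ∕ LR4 d576ff98 = 27930 12934e3f's ∕ 26648 2e9a8512's block): `Hr := recordHr`, `φ := −landauPotC ∘ recordD`, split =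
✓`recordD_eq_recordHr_add`, (21)-LR from ✓`reBond∕imBond_recordHr_mem_lan` + §4, clauses verbatim.
HONEST FRAMING.  Finite-torus linear algebra + bookkeeping; the (190) clauses are HYPOTHESES; nothing of Bałaban asserted; 27931 v9-L OPEN · kernel-certified modulo GAP-R4D
(director №490); K0⁷∕K-Ax OPEN; NODE O 0∕1; COUNT 8∕28 · K 1∕4 UNMOVED; finite `𝕋⁴_{L^K}` at fixed ε — NOT continuum ∕ OS ∕ Clay; **the Yang–Mills mass gap (Clay) is NOT proved.**
-/

noncomputable section

open scoped BigOperators RealInnerProductSpace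

namespace Summit.QuantumFields.YangMills.Theorems.PortU8

open Literature.MathematicalPhysics.QuantumFieldTheory.Balaban1983to89
open Literature.MathematicalPhysics.QuantumFieldTheory.Balaban1983to89.LatticeFieldCalculus (siteAvg siteAvgIter laplace diverg siteAvg_eq_blockSum)
open Literature.MathematicalPhysics.QuantumFieldTheory.Balaban1983to89.B14.Eq22Determines (blockIter blockIter_zero blockIter_succ)
open Literature.MathematicalPhysics.QuantumFieldTheory.BalabanImbrieJaffe1984to88.BIJ85LandauMinimizer442V1 (opsV1 opsV1_Qp opsV1_lap opsV1_dstar)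
open Literature.MathematicalPhysics.QuantumFieldTheory.BalabanImbrieJaffe1984to88.BIJ85AxialPropagator411 (BondSpace)
open Literature.MathematicalPhysics.QuantumFieldTheory.Balaban1983to89.B6SectAOperatorsV1 (ScalarSpace lapE inner_lapE_right lapE_apply)
open Summit.QuantumFields.YangMills.Theorems.K0RecordFormatNames

/-! ## §1  `coarsenTo = blockIter` -/

/-- The names file's `coarsenTo` IS the tree's iterated block map `blockIter` (same recursion). [cite: Balaban1987RG1, (0.1) p.251 (bookkeeping)] -/
theorem coarsenTo_eq_blockIter {P : Params} : ∀ (n : ℕ) (x : Site P 0), coarsenTo n x = blockIter n x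
  | 0, _ => rfl
  | n + 1, x => by
      show blockOf (coarsenTo n x) = blockOf (blockIter n x)
      rw [coarsenTo_eq_blockIter n x]

/-! ## §2  Block-constant functions and block sums under the iterated average -/

section Blocks

variable {P : Params} {V : Type*} [AddCommGroup V] [Module ℝ V]

/-- **Block-constant functions average to themselves**: `Q′_j (g ∘ blockIter j) = g` (standing range `j ≤ m + K`). [cite: Balaban1984PropagatorsI, (1.15) p.19, (1.20) p.20] -/
theorem siteAvgIter_blockConst : ∀ {j : ℕ}, j ≤ P.m + P.K → ∀ g : Site P j → V, siteAvgIter j (fun x : Site P 0 => g (blockIter j x)) = g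
  | 0, _, g => by funext x; rfl
  | j + 1, hj, g => by
      have IH := siteAvgIter_blockConst (j := j) (by omega) (fun z : Site P j => g (blockOf z))
      have hfun : (fun x : Site P 0 => g (blockIter (j + 1) x)) = fun x => (fun z : Site P j => g (blockOf z)) (blockIter j x) := by
        funext x; rw [blockIter_succ]
      show siteAvg (siteAvgIter j (fun x : Site P 0 => g (blockIter (j + 1) x))) = g
      rw [hfun, IH]
      funext y
      rw [siteAvg_eq_blockSum (by omega)]
      have hconst : ∑ x ∈ block y, (fun z : Site P j => g (blockOf z)) x = (block y).card • g y := by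
        rw [← Finset.sum_const]
        refine Finset.sum_congr rfl fun x hx => ?_
        have hx' : blockOf x = y := by simpa [block] using hx
        simp only [hx']
      rw [hconst, Site.card_block (by omega), ← Nat.cast_smul_eq_nsmul ℝ, smul_smul]
      have hL : ((P.L ^ P.d : ℕ) : ℝ) ≠ 0 := by exact_mod_cast pow_ne_zero _ P.L_pos.ne'
      rw [show (((P.L : ℝ) ^ P.d)⁻¹ * ((P.L ^ P.d : ℕ) : ℝ)) = 1 by push_cast; exact inv_mul_cancel₀ (by exact_mod_cast hL), one_smul]

/-- **The `j`-block sum is `(L^d)^j` times the iterated average** (standing range). [cite: Balaban1984PropagatorsI, (1.20) p.20] -/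
theorem sum_fiber_blockIter [DecidableEq V] : ∀ {j : ℕ}, j ≤ P.m + P.K → ∀ (h : Site P 0 → V) (y : Site P j),
    ∑ x ∈ Finset.univ.filter (fun x : Site P 0 => blockIter j x = y), h x = (((P.L : ℝ) ^ P.d) ^ j) • siteAvgIter j h y
  | 0, _, h, y => by
      have hs : Finset.univ.filter (fun x : Site P 0 => blockIter 0 x = y) = {y} := by
        ext x; simp
      rw [hs, Finset.sum_singleton, pow_zero, one_smul]; rfl
  | j + 1, hj, h, y => by
      classical
      have hmaps : ∀ x ∈ Finset.univ.filter (fun x : Site P 0 => blockIter (j + 1) x = y), blockIter j x ∈ block y := by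
        intro x hx
        have hx' : blockOf (blockIter j x) = y := by simpa using hx
        simpa [block] using hx'
      rw [← Finset.sum_fiberwise_of_maps_to hmaps]
      have hfib : ∀ z ∈ block y, (Finset.univ.filter (fun x : Site P 0 => blockIter (j + 1) x = y)).filter (fun x => blockIter j x = z) =
          Finset.univ.filter (fun x : Site P 0 => blockIter j x = z) := by
        intro z hz
        have hz' : blockOf z = y := by simpa [block] using hz
        ext x
        simp only [Finset.mem_filter, Finset.mem_univ, true_and, blockIter_succ]
        constructor
        · exact fun hx => hx.2
        · intro hx; exact ⟨by rw [hx, hz'], hx⟩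
      rw [Finset.sum_congr rfl fun z hz => by rw [hfib z hz, sum_fiber_blockIter (j := j) (by omega) h z], ← Finset.smul_sum]
      show (((P.L : ℝ) ^ P.d) ^ j) • ∑ z ∈ block y, siteAvgIter j h z = (((P.L : ℝ) ^ P.d) ^ (j + 1)) • siteAvg (siteAvgIter j h) y
      rw [siteAvg_eq_blockSum (by omega), smul_smul, pow_succ, mul_assoc,
        mul_inv_cancel₀ (pow_ne_zero _ (Nat.cast_ne_zero.mpr P.L_pos.ne')), mul_one]

end Blocks

/-! ## §3  `(ker Q′_j)ᗮ` = the block-constant site functions (the `(k+1)`-fold «`Q′*`-range» lemma) -/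

section KerQp

variable {P : Params}

/-- The real inner product on `ℓ²(T_η)` against a block-constant function, summed fibrewise: `⟪u, g ∘ B^j⟫ = Σ_y (L^d)^j (Q′_j u)(y) g(y)`.
[cite: Balaban1984PropagatorsI, (1.15) p.19 (bookkeeping)] -/
theorem inner_blockConst_eq {j : ℕ} (hj : j ≤ P.m + P.K) (u : ScalarSpace P) (g : Site P j → ℝ) :
    inner ℝ u (WithLp.toLp 2 (fun x : Site P 0 => g (blockIter j x)) : ScalarSpace P) =
      ∑ y : Site P j, (((P.L : ℝ) ^ P.d) ^ j) * siteAvgIter j (WithLp.ofLp u) y * g y := by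
  classical
  have h1 : inner ℝ u (WithLp.toLp 2 (fun x : Site P 0 => g (blockIter j x)) : ScalarSpace P) = ∑ x : Site P 0, u x * g (blockIter j x) := by
    rw [PiLp.inner_apply]
    refine Finset.sum_congr rfl fun x _ => ?_
    simp [mul_comm]
  rw [h1, ← Finset.sum_fiberwise_of_maps_to (s := Finset.univ) (t := Finset.univ) (g := fun x : Site P 0 => blockIter j x)
    (fun _ _ => Finset.mem_univ _)]
  refine Finset.sum_congr rfl fun y _ => ?_
  have hfac : ∑ x ∈ Finset.univ.filter (fun x : Site P 0 => blockIter j x = y), u x * g (blockIter j x) =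
      (∑ x ∈ Finset.univ.filter (fun x : Site P 0 => blockIter j x = y), (WithLp.ofLp u) x) * g y := by
    rw [Finset.sum_mul]
    refine Finset.sum_congr rfl fun x hx => ?_
    have hx' : blockIter j x = y := by simpa using hx
    rw [hx']
  rw [hfac, sum_fiber_blockIter hj (WithLp.ofLp u) y, smul_eq_mul]

/-- ★ **THE `(k+1)`-FOLD «`Q′*`-RANGE» LEMMA** (CRIT-1 RULING (P), port-lead O-5 (i)): a site function is orthogonal to `N(Q′_j) = ker Q′_j` iff it is CONSTANT ON THE
`j`-BLOCKS, i.e. a pullback of a function on `T^{(j)}` along `blockIter j` (standing range `j ≤ m + K`; any `c, s`). [cite: Balaban1984PropagatorsI, (1.15) p.19, p.25 (text)] -/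
theorem mem_orthogonal_ker_Qp_iff {j : ℕ} (hj : j ≤ P.m + P.K) (c s : ℝ) (f : ScalarSpace P) :
    f ∈ (LinearMap.ker (opsV1 P j c s).Qp)ᗮ ↔ ∃ g : Site P j → ℝ, ∀ x : Site P 0, f x = g (blockIter j x) := by
  classical
  have hker : ∀ u : ScalarSpace P, u ∈ LinearMap.ker (opsV1 P j c s).Qp ↔ siteAvgIter j (WithLp.ofLp u) = 0 := fun u => by
    rw [LinearMap.mem_ker, opsV1_Qp]
  -- block-constant functions are orthogonal to the kernel
  have hconst : ∀ g : Site P j → ℝ, (WithLp.toLp 2 (fun x : Site P 0 => g (blockIter j x)) : ScalarSpace P) ∈ (LinearMap.ker (opsV1 P j c s).Qp)ᗮ := by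
    intro g
    rw [Submodule.mem_orthogonal]
    intro u hu
    rw [inner_blockConst_eq hj u g, (hker u).1 hu]
    simp
  constructor
  · intro hf
    refine ⟨siteAvgIter j (WithLp.ofLp f), fun x => ?_⟩
    set w : ScalarSpace P := WithLp.toLp 2 (fun x : Site P 0 => siteAvgIter j (WithLp.ofLp f) (blockIter j x)) with hw
    -- `f − w ∈ ker Q′` and `f − w ⊥ ker Q′`, hence `f = w`
    have hmem : f - w ∈ LinearMap.ker (opsV1 P j c s).Qp := by
      rw [hker, WithLp.ofLp_sub, Literature.MathematicalPhysics.QuantumFieldTheory.BalabanImbrieJaffe1984to88.BIJ85GaugeFunction5113.siteAvgIter_sub]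
      have : siteAvgIter j (WithLp.ofLp w) = siteAvgIter j (WithLp.ofLp f) := by
        rw [hw]; exact siteAvgIter_blockConst hj _
      rw [this, sub_self]
    have horth : f - w ∈ (LinearMap.ker (opsV1 P j c s).Qp)ᗮ := Submodule.sub_mem _ hf (hconst _)
    have hzero : f - w = 0 := by
      have h := Submodule.inner_right_of_mem_orthogonal hmem horth
      exact inner_self_eq_zero.1 h
    have hfw : f = w := sub_eq_zero.1 hzero
    have := congrArg (fun v : ScalarSpace P => v x) hfw
    simpa [hw] using this
  · rintro ⟨g, hg⟩
    have hf : f = (WithLp.toLp 2 (fun x : Site P 0 => g (blockIter j x)) : ScalarSpace P) := by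
      ext x; simpa using hg x
    rw [hf]; exact hconst g

/-- The same with the names file's `coarsenTo`. [cite: Balaban1984PropagatorsI, (1.15) p.19 (bookkeeping)] -/
theorem mem_orthogonal_ker_Qp_iff_coarsenTo {j : ℕ} (hj : j ≤ P.m + P.K) (c s : ℝ) (f : ScalarSpace P) :
    f ∈ (LinearMap.ker (opsV1 P j c s).Qp)ᗮ ↔ ∃ g : Site P j → ℝ, ∀ x : Site P 0, f x = g (coarsenTo j x) := by
  rw [mem_orthogonal_ker_Qp_iff hj c s f]
  simp only [coarsenTo_eq_blockIter]

end KerQp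

/-! ## §4  A Landau-subspace bond field has block-constant `Δ∂*` -/

section Landau

variable {P : Params}

/-- `Δ` of the V1 operators is symmetric on `ℓ²(T_η)`. [cite: Balaban1984PropagatorsII, (2.8) p.224 (bookkeeping)] -/
theorem inner_opsV1_lap_comm (j : ℕ) (c s : ℝ) (f g : ScalarSpace P) :
    inner ℝ ((opsV1 P j c s).lap f) g = inner ℝ f ((opsV1 P j c s).lap g) := by
  rw [B6SectAWholeTorusBridge.lap_opsV1_eq_smul_lapE, LinearMap.smul_apply, LinearMap.smul_apply, inner_smul_left, inner_smul_right,
    real_inner_comm, inner_lapE_right, inner_lapE_right, real_inner_comm]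
  simp

/-- ★ **`A ∈ lan ⇒ Δ∂*A ⊥ N(Q′_j)`**: «R is an orthogonal projection on ΔN(Q′)» ([B5] p.25) read through `projR_eq_zero_iff` and the symmetry of `Δ`.
[cite: Balaban1984PropagatorsI, p.25 (text), (1.47) p.26; Balaban1985Variational, (21) p.281] -/
theorem lap_dstar_mem_orthogonal_of_mem_lan (j : ℕ) (c s : ℝ) {A : BondSpace P} (hA : A ∈ B5Eq164LandauV1.lan P j c s) :
    (opsV1 P j c s).lap ((opsV1 P j c s).dstar A) ∈ (LinearMap.ker (opsV1 P j c s).Qp)ᗮ := by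
  rw [B5Eq164LandauV1.mem_lan, B5Eq147TorusBridge.projR_eq_zero_iff] at hA
  rw [Submodule.mem_orthogonal]
  intro l hl
  rw [← inner_opsV1_lap_comm]
  exact hA l (LinearMap.mem_ker.1 hl)

/-- ★ **`A ∈ lan ⇒ Δ∂*A` IS BLOCK-CONSTANT** (standing range): `∃ g, ∀ x, (Δ∂*A)(x) = g (blockIter j x)`. [cite: Balaban1984PropagatorsI, p.25 (text); Balaban1985Variational, (21) p.281] -/
theorem lap_dstar_blockConst_of_mem_lan {j : ℕ} (hj : j ≤ P.m + P.K) (c s : ℝ) {A : BondSpace P} (hA : A ∈ B5Eq164LandauV1.lan P j c s) :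
    ∃ g : Site P j → ℝ, ∀ x : Site P 0, ((opsV1 P j c s).lap ((opsV1 P j c s).dstar A)) x = g (blockIter j x) :=
  (mem_orthogonal_ker_Qp_iff hj c s _).1 (lap_dstar_mem_orthogonal_of_mem_lan j c s hA)

/-- At the plain-lattice weights `c = s = 1`: `laplace 1 (diverg 1 A)` is block-constant for `A ∈ lan P j 1 1`. [cite: Balaban1985Variational, (21) p.281 (bookkeeping)] -/
theorem laplace_diverg_blockConst_of_mem_lan {j : ℕ} (hj : j ≤ P.m + P.K) {A : BondSpace P} (hA : A ∈ B5Eq164LandauV1.lan P j 1 1) :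
    ∃ g : Site P j → ℝ, ∀ x : Site P 0, laplace 1 (diverg 1 (WithLp.ofLp A)) x = g (blockIter j x) := by
  obtain ⟨g, hg⟩ := lap_dstar_blockConst_of_mem_lan hj 1 1 hA
  refine ⟨g, fun x => ?_⟩
  have h := hg x
  simpa [opsV1_lap, opsV1_dstar] using h

/-- **Complex bond functions, entrywise**: if the real and imaginary parts of `H : bonds → ℂ` lie in `lan P j 1 1`, then `laplace 1 (diverg 1 H)` is block-constant.
[cite: Balaban1985Variational, (21) p.281 (bookkeeping)] -/
theorem laplace_diverg_blockConst_complex {j : ℕ} (hj : j ≤ P.m + P.K) (H : PBond P 0 → ℂ)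
    (hre : (WithLp.toLp 2 (fun b => (H b).re) : BondSpace P) ∈ B5Eq164LandauV1.lan P j 1 1)
    (him : (WithLp.toLp 2 (fun b => (H b).im) : BondSpace P) ∈ B5Eq164LandauV1.lan P j 1 1) :
    ∃ g : Site P j → ℂ, ∀ x : Site P 0, laplace 1 (diverg 1 H) x = g (blockIter j x) := by
  obtain ⟨gr, hgr⟩ := laplace_diverg_blockConst_of_mem_lan hj hre
  obtain ⟨gi, hgi⟩ := laplace_diverg_blockConst_of_mem_lan hj him
  refine ⟨fun y => (gr y : ℂ) + (gi y : ℂ) * Complex.I, fun x => ?_⟩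
  -- `re` and `im` commute with the lattice operators (ℝ-linear)
  have hmap : ∀ (φ : ℂ →ₗ[ℝ] ℝ), φ (laplace 1 (diverg 1 H) x) = laplace 1 (diverg 1 (fun b => φ (H b))) x := by
    intro φ
    simp only [laplace, diverg, map_sum, map_smul, map_sub, map_add]
  have hR : (laplace 1 (diverg 1 H) x).re = gr (blockIter j x) := by
    have h := hmap Complex.reLm
    simp only [Complex.reLm_coe] at h
    rw [h, ← hgr x]
  have hI : (laplace 1 (diverg 1 H) x).im = gi (blockIter j x) := by
    have h := hmap Complex.imLm
    simp only [Complex.imLm_coe] at h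
    rw [h, ← hgi x]
  rw [← Complex.re_add_im (laplace 1 (diverg 1 H) x), hR, hI]

end Landau



/-! ## §5  THE BRIDGE: 27931 v9-L's TokP9L4‴ (four clauses ON `recordHr`) ⟹ the old TokP9L4 of 27930∕26648 (`∃ Hr φ, D = Hr + dφ ∧ (21)-LR ∧` four clauses) -/

section Bridge

open Literature.MathematicalPhysics.QuantumFieldTheory.Balaban1983to89.Node00
open Literature.MathematicalPhysics.QuantumFieldTheory.Balaban1983to89.T4Continuum (T4Family)

/-- ★★ **THE PER-POINT BRIDGE** (token bodies VERBATIM): at one `(k, n)`, colour `a`, direction `μ`, source `y`, the TokP9L4‴ body of 27931 v9-L (ce176c41) — the four (190)-clauses on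
`Hr := recordHr F θ k K a (μ, y)` — implies the old TokP9L4 body (LR4 d576ff98 ∕ 27930 12934e3f ∕ 26648 2e9a8512): witnesses `Hr := recordHr`, `φ := −landauPotC ∘ recordD` entrywise;
the split is ✓`recordD_eq_recordHr_add`; the (21)-LR conjunct is §4 applied to ✓`reBond∕imBond_recordHr_mem_lan` (the token's LHS is `laplace 1 (diverg 1 Hr)` entrywise — two sign flips
cancel); the clauses pass through. [cite: Balaban1985Variational, Prop. 9 p.309, (190) p.308, (21) p.281; Balaban1984PropagatorsI, p.25 (text)] -/
theorem tokP9L4_old_of_new_at (F : T4Family) (Mc : ℕ) (a₀ ε₂₉ C₉' δ₉ : ℝ) (k n : ℕ) :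
    letI θ := (Summit.QuantumFields.YangMills.Theorems.K0RecordFormatNames.thetaFill F a₀ ε₂₉); letI := θ.instVβ₁; letI := θ.instVβ₂; letI := θ.instιβ;
    ∀ (a : θ.ιβ) (μ : Fin (F.P (Summit.QuantumFields.YangMills.Theorems.K0RecordFormatNames.recordK₀ F Mc k + n)).d) (y : Literature.MathematicalPhysics.QuantumFieldTheory.Balaban1983to89.Site (F.P (Summit.QuantumFields.YangMills.Theorems.K0RecordFormatNames.recordK₀ F Mc k + n)) (k + 1)),
      (letI Hr : Literature.MathematicalPhysics.QuantumFieldTheory.Balaban1983to89.PBond (F.P (Summit.QuantumFields.YangMills.Theorems.K0RecordFormatNames.recordK₀ F Mc k + n)) 0 → Fin 2 → Fin 2 → ℂ := fun b' => Summit.QuantumFields.YangMills.Theorems.K0RecordFormatNames.recordHr F θ k (Summit.QuantumFields.YangMills.Theorems.K0RecordFormatNames.recordK₀ F Mc k + n) a (μ, y) b'; ∀ b : Literature.MathematicalPhysics.QuantumFieldTheory.Balaban1983to89.PBond (F.P (Summit.QuantumFields.YangMills.Theorems.K0RecordFormatNames.recordK₀ F Mc k + n)) 0, ‖Hr b‖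 ≤ C₉' * (F.P (Summit.QuantumFields.YangMills.Theorems.K0RecordFormatNames.recordK₀ F Mc k + n)).eta (k + 1) * Real.exp (-(δ₉ * (Literature.MathematicalPhysics.QuantumFieldTheory.Balaban1983to89.Site.tdist (Summit.QuantumFields.YangMills.Theorems.K0RecordFormatNames.coarsenTo (k + 1) b.src) y : ℝ))) ∧ (∀ ν : Fin (F.P (Summit.QuantumFields.YangMills.Theorems.K0RecordFormatNames.recordK₀ F Mc k + n)).d, ‖Hr (⟨b.src.shift ν, b.dir⟩ : Literature.MathematicalPhysics.QuantumFieldTheory.Balaban1983to89.PBond (F.P (Summit.QuantumFields.YangMills.Theorems.K0RecordFormatNames.recordK₀ F Mc k + n)) 0) - Hr b‖ ≤ C₉' * (F.P (Summit.QuantumFields.YangMills.Theorems.K0RecordFormatNames.recordK₀ F Mc k + n)).eta (k + 1) ^ 2 * Real.exp (-(δ₉ * (Literature.MathematicalPhysics.QuantumFieldTheory.Balaban1983to89.Site.tdist (Summit.QuantumFields.YangMills.Theorems.K0RecordFormatNames.coarsenTo (k + 1) b.src) y : ℝ)))) ∧ ‖∑ ν : Fin (F.P (Summit.QuantumFields.YangMills.Theorems.K0RecordFormatNames.recordK₀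 F Mc k + n)).d, (Hr (⟨b.src.shift ν, b.dir⟩ : Literature.MathematicalPhysics.QuantumFieldTheory.Balaban1983to89.PBond (F.P (Summit.QuantumFields.YangMills.Theorems.K0RecordFormatNames.recordK₀ F Mc k + n)) 0) - (2 : ℂ) • Hr b + Hr (⟨b.src.unshift ν, b.dir⟩ : Literature.MathematicalPhysics.QuantumFieldTheory.Balaban1983to89.PBond (F.P (Summit.QuantumFields.YangMills.Theorems.K0RecordFormatNames.recordK₀ F Mc k + n)) 0))‖ ≤ C₉' * (F.P (Summit.QuantumFields.YangMills.Theorems.K0RecordFormatNames.recordK₀ F Mc k + n)).eta (k + 1) ^ 3 * Real.exp (-(δ₉ * (Literature.MathematicalPhysics.QuantumFieldTheory.Balaban1983to89.Site.tdist (Summit.QuantumFields.YangMills.Theorems.K0RecordFormatNames.coarsenTo (k + 1) b.src) y : ℝ))) ∧ ‖∑ ν : Fin (F.P (Summit.QuantumFields.YangMills.Theorems.K0RecordFormatNames.recordK₀ F Mc k + n)).d, ((Hr (⟨b.src, b.dir⟩ : Literature.MathematicalPhysics.QuantumFieldTheory.Balaban1983to89.PBond (F.P (Summit.QuantumFields.YangMills.Theorems.K0RecordFormatNames.recordK₀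 F Mc k + n)) 0) + Hr (⟨(b.src).shift b.dir, ν⟩ : Literature.MathematicalPhysics.QuantumFieldTheory.Balaban1983to89.PBond (F.P (Summit.QuantumFields.YangMills.Theorems.K0RecordFormatNames.recordK₀ F Mc k + n)) 0) - Hr (⟨(b.src).shift ν, b.dir⟩ : Literature.MathematicalPhysics.QuantumFieldTheory.Balaban1983to89.PBond (F.P (Summit.QuantumFields.YangMills.Theorems.K0RecordFormatNames.recordK₀ F Mc k + n)) 0) - Hr (⟨b.src, ν⟩ : Literature.MathematicalPhysics.QuantumFieldTheory.Balaban1983to89.PBond (F.P (Summit.QuantumFields.YangMills.Theorems.K0RecordFormatNames.recordK₀ F Mc k + n)) 0)) - (Hr (⟨b.src.unshift ν, b.dir⟩ : Literature.MathematicalPhysics.QuantumFieldTheory.Balaban1983to89.PBond (F.P (Summit.QuantumFields.YangMills.Theorems.K0RecordFormatNames.recordK₀ F Mc k + n)) 0) + Hr (⟨(b.src.unshift ν).shift b.dir, ν⟩ : Literature.MathematicalPhysics.QuantumFieldTheory.Balaban1983to89.PBond (F.P (Summit.QuantumFields.YangMills.Theorems.K0RecordFormatNames.recordK₀ F Mc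 k + n)) 0) - Hr (⟨(b.src.unshift ν).shift ν, b.dir⟩ : Literature.MathematicalPhysics.QuantumFieldTheory.Balaban1983to89.PBond (F.P (Summit.QuantumFields.YangMills.Theorems.K0RecordFormatNames.recordK₀ F Mc k + n)) 0) - Hr (⟨b.src.unshift ν, ν⟩ : Literature.MathematicalPhysics.QuantumFieldTheory.Balaban1983to89.PBond (F.P (Summit.QuantumFields.YangMills.Theorems.K0RecordFormatNames.recordK₀ F Mc k + n)) 0)))‖ ≤ C₉' * (F.P (Summit.QuantumFields.YangMills.Theorems.K0RecordFormatNames.recordK₀ F Mc k + n)).eta (k + 1) ^ 3 * Real.exp (-(δ₉ * (Literature.MathematicalPhysics.QuantumFieldTheory.Balaban1983to89.Site.tdist (Summit.QuantumFields.YangMills.Theorems.K0RecordFormatNames.coarsenTo (k + 1) b.src) y : ℝ)))) →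
      (letI D := fderiv ℝ (fun B : Summit.QuantumFields.YangMills.Theorems.K0RecordFormatNames.recordW F a₀ ε₂₉ k (Summit.QuantumFields.YangMills.Theorems.K0RecordFormatNames.recordK₀ F Mc k + n) => fun (b : Literature.MathematicalPhysics.QuantumFieldTheory.Balaban1983to89.PBond (F.P (Summit.QuantumFields.YangMills.Theorems.K0RecordFormatNames.recordK₀ F Mc k + n)) 0) (i i' : Fin 2) => ((Summit.QuantumFields.YangMills.Theorems.K0RecordFormatNames.recordBgField F θ k (Summit.QuantumFields.YangMills.Theorems.K0RecordFormatNames.recordK₀ F Mc k + n) B b : Literature.MathematicalPhysics.QuantumFieldTheory.Balaban1983to89.Node00.SU 2) : Matrix (Fin 2) (Fin 2) ℂ) i i') 0 (Pi.single μ (Pi.single y (θ.bV a))); ∃ (Hr : Literature.MathematicalPhysics.QuantumFieldTheory.Balaban1983to89.PBond (F.P (Summit.QuantumFields.YangMills.Theorems.K0RecordFormatNames.recordK₀ F Mc k + n)) 0 → Fin 2 → Fin 2 → ℂ) (φ : Literature.MathematicalPhysics.QuantumFieldTheory.Balaban1983to89.Site (F.P (Summit.QuantumFields.YangMills.Theorems.K0RecordFormatNames.recordK₀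 F Mc k + n)) 0 → Fin 2 → Fin 2 → ℂ), (∀ b : Literature.MathematicalPhysics.QuantumFieldTheory.Balaban1983to89.PBond (F.P (Summit.QuantumFields.YangMills.Theorems.K0RecordFormatNames.recordK₀ F Mc k + n)) 0, D b = Hr b + (φ b.src - φ (b.src.shift b.dir))) ∧ (∃ μc : Literature.MathematicalPhysics.QuantumFieldTheory.Balaban1983to89.Site (F.P (Summit.QuantumFields.YangMills.Theorems.K0RecordFormatNames.recordK₀ F Mc k + n)) (k + 1) → Fin 2 → Fin 2 → ℂ, ∀ x : Literature.MathematicalPhysics.QuantumFieldTheory.Balaban1983to89.Site (F.P (Summit.QuantumFields.YangMills.Theorems.K0RecordFormatNames.recordK₀ F Mc k + n)) 0, letI dv := (fun x' : Literature.MathematicalPhysics.QuantumFieldTheory.Balaban1983to89.Site (F.P (Summit.QuantumFields.YangMills.Theorems.K0RecordFormatNames.recordK₀ F Mc k + n)) 0 => ∑ ν : Fin (F.P (Summit.QuantumFields.YangMills.Theorems.K0RecordFormatNames.recordK₀ F Mc k + n)).d, (Hr ⟨x', ν⟩ - Hr ⟨x'.unshift ν, ν⟩)); ∑ ν : Fin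 (F.P (Summit.QuantumFields.YangMills.Theorems.K0RecordFormatNames.recordK₀ F Mc k + n)).d, (dv (x.shift ν) - (2 : ℂ) • dv x + dv (x.unshift ν)) = μc (Summit.QuantumFields.YangMills.Theorems.K0RecordFormatNames.coarsenTo (k + 1) x)) ∧ ∀ b : Literature.MathematicalPhysics.QuantumFieldTheory.Balaban1983to89.PBond (F.P (Summit.QuantumFields.YangMills.Theorems.K0RecordFormatNames.recordK₀ F Mc k + n)) 0, ‖Hr b‖ ≤ C₉' * (F.P (Summit.QuantumFields.YangMills.Theorems.K0RecordFormatNames.recordK₀ F Mc k + n)).eta (k + 1) * Real.exp (-(δ₉ * (Literature.MathematicalPhysics.QuantumFieldTheory.Balaban1983to89.Site.tdist (Summit.QuantumFields.YangMills.Theorems.K0RecordFormatNames.coarsenTo (k + 1) b.src) y : ℝ))) ∧ (∀ ν : Fin (F.P (Summit.QuantumFields.YangMills.Theorems.K0RecordFormatNames.recordK₀ F Mc k + n)).d, ‖Hr (⟨b.src.shift ν, b.dir⟩ : Literature.MathematicalPhysics.QuantumFieldTheory.Balaban1983to89.PBond (F.P (Summit.QuantumFields.YangMills.Theorems.K0RecordFormatNames.recordK₀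 F Mc k + n)) 0) - Hr b‖ ≤ C₉' * (F.P (Summit.QuantumFields.YangMills.Theorems.K0RecordFormatNames.recordK₀ F Mc k + n)).eta (k + 1) ^ 2 * Real.exp (-(δ₉ * (Literature.MathematicalPhysics.QuantumFieldTheory.Balaban1983to89.Site.tdist (Summit.QuantumFields.YangMills.Theorems.K0RecordFormatNames.coarsenTo (k + 1) b.src) y : ℝ)))) ∧ ‖∑ ν : Fin (F.P (Summit.QuantumFields.YangMills.Theorems.K0RecordFormatNames.recordK₀ F Mc k + n)).d, (Hr (⟨b.src.shift ν, b.dir⟩ : Literature.MathematicalPhysics.QuantumFieldTheory.Balaban1983to89.PBond (F.P (Summit.QuantumFields.YangMills.Theorems.K0RecordFormatNames.recordK₀ F Mc k + n)) 0) - (2 : ℂ) • Hr b + Hr (⟨b.src.unshift ν, b.dir⟩ : Literature.MathematicalPhysics.QuantumFieldTheory.Balaban1983to89.PBond (F.P (Summit.QuantumFields.YangMills.Theorems.K0RecordFormatNames.recordK₀ F Mc k + n)) 0))‖ ≤ C₉' * (F.P (Summit.QuantumFields.YangMills.Theorems.K0RecordFormatNames.recordK₀ F Mc k + n)).eta (k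 + 1) ^ 3 * Real.exp (-(δ₉ * (Literature.MathematicalPhysics.QuantumFieldTheory.Balaban1983to89.Site.tdist (Summit.QuantumFields.YangMills.Theorems.K0RecordFormatNames.coarsenTo (k + 1) b.src) y : ℝ))) ∧ ‖∑ ν : Fin (F.P (Summit.QuantumFields.YangMills.Theorems.K0RecordFormatNames.recordK₀ F Mc k + n)).d, ((Hr (⟨b.src, b.dir⟩ : Literature.MathematicalPhysics.QuantumFieldTheory.Balaban1983to89.PBond (F.P (Summit.QuantumFields.YangMills.Theorems.K0RecordFormatNames.recordK₀ F Mc k + n)) 0) + Hr (⟨(b.src).shift b.dir, ν⟩ : Literature.MathematicalPhysics.QuantumFieldTheory.Balaban1983to89.PBond (F.P (Summit.QuantumFields.YangMills.Theorems.K0RecordFormatNames.recordK₀ F Mc k + n)) 0) - Hr (⟨(b.src).shift ν, b.dir⟩ : Literature.MathematicalPhysics.QuantumFieldTheory.Balaban1983to89.PBond (F.P (Summit.QuantumFields.YangMills.Theorems.K0RecordFormatNames.recordK₀ F Mc k + n)) 0) - Hr (⟨b.src, ν⟩ : Literature.MathematicalPhysics.QuantumFieldTheory.Balaban1983to89.PBond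 (F.P (Summit.QuantumFields.YangMills.Theorems.K0RecordFormatNames.recordK₀ F Mc k + n)) 0)) - (Hr (⟨b.src.unshift ν, b.dir⟩ : Literature.MathematicalPhysics.QuantumFieldTheory.Balaban1983to89.PBond (F.P (Summit.QuantumFields.YangMills.Theorems.K0RecordFormatNames.recordK₀ F Mc k + n)) 0) + Hr (⟨(b.src.unshift ν).shift b.dir, ν⟩ : Literature.MathematicalPhysics.QuantumFieldTheory.Balaban1983to89.PBond (F.P (Summit.QuantumFields.YangMills.Theorems.K0RecordFormatNames.recordK₀ F Mc k + n)) 0) - Hr (⟨(b.src.unshift ν).shift ν, b.dir⟩ : Literature.MathematicalPhysics.QuantumFieldTheory.Balaban1983to89.PBond (F.P (Summit.QuantumFields.YangMills.Theorems.K0RecordFormatNames.recordK₀ F Mc k + n)) 0) - Hr (⟨b.src.unshift ν, ν⟩ : Literature.MathematicalPhysics.QuantumFieldTheory.Balaban1983to89.PBond (F.P (Summit.QuantumFields.YangMills.Theorems.K0RecordFormatNames.recordK₀ F Mc k + n)) 0)))‖ ≤ C₉' * (F.P (Summit.QuantumFields.YangMills.Theorems.K0RecordFormatNames.recordK₀ F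 Mc k + n)).eta (k + 1) ^ 3 * Real.exp (-(δ₉ * (Literature.MathematicalPhysics.QuantumFieldTheory.Balaban1983to89.Site.tdist (Summit.QuantumFields.YangMills.Theorems.K0RecordFormatNames.coarsenTo (k + 1) b.src) y : ℝ)))) := by
  letI θ := (Summit.QuantumFields.YangMills.Theorems.K0RecordFormatNames.thetaFill F a₀ ε₂₉)
  letI := θ.instVβ₁; letI := θ.instVβ₂; letI := θ.instιβ
  intro a μ y hnew
  have hk : k + 1 ≤ (F.P (Summit.QuantumFields.YangMills.Theorems.K0RecordFormatNames.recordK₀ F Mc k + n)).m + (F.P (Summit.QuantumFields.YangMills.Theorems.K0RecordFormatNames.recordK₀ F Mc k + n)).K := by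
    simp only [T4Family.P_m, T4Family.P_K]; unfold Summit.QuantumFields.YangMills.Theorems.K0RecordFormatNames.recordK₀; omega
  refine ⟨fun b' => recordHr F θ k (Summit.QuantumFields.YangMills.Theorems.K0RecordFormatNames.recordK₀ F Mc k + n) a (μ, y) b', fun x i i' => -landauPotC F k (Summit.QuantumFields.YangMills.Theorems.K0RecordFormatNames.recordK₀ F Mc k + n) (fun b' => recordD F θ k (Summit.QuantumFields.YangMills.Theorems.K0RecordFormatNames.recordK₀ F Mc k + n) a (μ, y) b' i i') x, ?_, ?_, hnew⟩
  · intro b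
    funext i i'
    show recordD F θ k (Summit.QuantumFields.YangMills.Theorems.K0RecordFormatNames.recordK₀ F Mc k + n) a (μ, y) b i i' = _
    rw [recordD_eq_recordHr_add]
    simp only [PBond.tgt, Pi.add_apply, Pi.sub_apply]
    ring
  · have hg : ∀ i i' : Fin 2, ∃ g : Literature.MathematicalPhysics.QuantumFieldTheory.Balaban1983to89.Site (F.P (Summit.QuantumFields.YangMills.Theorems.K0RecordFormatNames.recordK₀ F Mc k + n)) (k + 1) → ℂ,
        ∀ x, laplace 1 (diverg 1 (fun b => recordHr F θ k (Summit.QuantumFields.YangMills.Theorems.K0RecordFormatNames.recordK₀ F Mc k + n) a (μ, y) b i i')) x = g (B14.Eq22Determines.blockIter (k + 1) x) :=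
      fun i i' => laplace_diverg_blockConst_complex hk _ (reBond_recordHr_mem_lan F θ hk a (μ, y) i i') (imBond_recordHr_mem_lan F θ hk a (μ, y) i i')
    choose g hg using hg
    refine ⟨fun z i i' => g i i' z, fun x => ?_⟩
    funext i i'
    beta_reduce
    rw [coarsenTo_eq_blockIter, ← hg i i' x]
    simp only [laplace, one_pow, one_smul, Finset.sum_apply, Pi.sub_apply, Pi.add_apply, Pi.smul_apply, smul_eq_mul]
    refine Finset.sum_congr rfl fun ν _ => ?_
    simp only [diverg, one_smul, Finset.sum_sub_distrib]
    ring

/-- ★★ **THE WHOLE-TOKEN BRIDGE**: TokP9L4‴ of 27931 v9-L ⟹ the old TokP9L4 of the LR4 texts (27930 ⁸-Ax-LR4, 26648 v4Ax-LR4), same constants `C₉′, δ₉` — so the K0ᴬ JOIN can carry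
v9-L's antecedent list and feed the old block once (CRIT-1 RULING (P)→(α)). [cite: Balaban1985Variational, Prop. 9 p.309, (190) p.308, (21) p.281] -/
theorem tokP9L4_old_of_new (F : T4Family) (Mc : ℕ) (a₀ : ℝ) :
    (∃ C₉' δ₉ : ℝ, 0 ≤ C₉' ∧ 0 < δ₉ ∧ ∀ (k n : ℕ) (ε₂₉ : ℝ), 0 < ε₂₉ → letI θ := Summit.QuantumFields.YangMills.Theorems.K0RecordFormatNames.thetaFill F a₀ ε₂₉; letI := θ.instVβ₁; letI := θ.instVβ₂; letI := θ.instιβ; ∀ (a : θ.ιβ) (μ : Fin (F.P (Summit.QuantumFields.YangMills.Theorems.K0RecordFormatNames.recordK₀ F Mc k + n)).d) (y : Literature.MathematicalPhysics.QuantumFieldTheory.Balaban1983to89.Site (F.P (Summit.QuantumFields.YangMills.Theorems.K0RecordFormatNames.recordK₀ F Mc k + n)) (k + 1)), letI Hr : Literature.MathematicalPhysics.QuantumFieldTheory.Balaban1983to89.PBond (F.P (Summit.QuantumFields.YangMills.Theorems.K0RecordFormatNames.recordK₀ F Mc k + n)) 0 → Fin 2 → Fin 2 → ℂ := fun b' =>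 Summit.QuantumFields.YangMills.Theorems.K0RecordFormatNames.recordHr F θ k (Summit.QuantumFields.YangMills.Theorems.K0RecordFormatNames.recordK₀ F Mc k + n) a (μ, y) b'; ∀ b : Literature.MathematicalPhysics.QuantumFieldTheory.Balaban1983to89.PBond (F.P (Summit.QuantumFields.YangMills.Theorems.K0RecordFormatNames.recordK₀ F Mc k + n)) 0, ‖Hr b‖ ≤ C₉' * (F.P (Summit.QuantumFields.YangMills.Theorems.K0RecordFormatNames.recordK₀ F Mc k + n)).eta (k + 1) * Real.exp (-(δ₉ * (Literature.MathematicalPhysics.QuantumFieldTheory.Balaban1983to89.Site.tdist (Summit.QuantumFields.YangMills.Theorems.K0RecordFormatNames.coarsenTo (k + 1) b.src) y : ℝ))) ∧ (∀ ν : Fin (F.P (Summit.QuantumFields.YangMills.Theorems.K0RecordFormatNames.recordK₀ F Mc k + n)).d, ‖Hr (⟨b.src.shift ν, b.dir⟩ : Literature.MathematicalPhysics.QuantumFieldTheory.Balaban1983to89.PBond (F.P (Summit.QuantumFields.YangMills.Theorems.K0RecordFormatNames.recordK₀ F Mc k + n)) 0) - Hr b‖ ≤ C₉' * (F.P (Summit.QuantumFields.YangMills.Theorems.K0RecordFormatNames.recordK₀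 F Mc k + n)).eta (k + 1) ^ 2 * Real.exp (-(δ₉ * (Literature.MathematicalPhysics.QuantumFieldTheory.Balaban1983to89.Site.tdist (Summit.QuantumFields.YangMills.Theorems.K0RecordFormatNames.coarsenTo (k + 1) b.src) y : ℝ)))) ∧ ‖∑ ν : Fin (F.P (Summit.QuantumFields.YangMills.Theorems.K0RecordFormatNames.recordK₀ F Mc k + n)).d, (Hr (⟨b.src.shift ν, b.dir⟩ : Literature.MathematicalPhysics.QuantumFieldTheory.Balaban1983to89.PBond (F.P (Summit.QuantumFields.YangMills.Theorems.K0RecordFormatNames.recordK₀ F Mc k + n)) 0) - (2 : ℂ) • Hr b + Hr (⟨b.src.unshift ν, b.dir⟩ : Literature.MathematicalPhysics.QuantumFieldTheory.Balaban1983to89.PBond (F.P (Summit.QuantumFields.YangMills.Theorems.K0RecordFormatNames.recordK₀ F Mc k + n)) 0))‖ ≤ C₉' * (F.P (Summit.QuantumFields.YangMills.Theorems.K0RecordFormatNames.recordK₀ F Mc k + n)).eta (k + 1) ^ 3 * Real.exp (-(δ₉ * (Literature.MathematicalPhysics.QuantumFieldTheory.Balaban1983to89.Site.tdist (Summit.QuantumFields.YangMills.Theorems.K0RecordFormatNames.coarsenTo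 (k + 1) b.src) y : ℝ))) ∧ ‖∑ ν : Fin (F.P (Summit.QuantumFields.YangMills.Theorems.K0RecordFormatNames.recordK₀ F Mc k + n)).d, ((Hr (⟨b.src, b.dir⟩ : Literature.MathematicalPhysics.QuantumFieldTheory.Balaban1983to89.PBond (F.P (Summit.QuantumFields.YangMills.Theorems.K0RecordFormatNames.recordK₀ F Mc k + n)) 0) + Hr (⟨(b.src).shift b.dir, ν⟩ : Literature.MathematicalPhysics.QuantumFieldTheory.Balaban1983to89.PBond (F.P (Summit.QuantumFields.YangMills.Theorems.K0RecordFormatNames.recordK₀ F Mc k + n)) 0) - Hr (⟨(b.src).shift ν, b.dir⟩ : Literature.MathematicalPhysics.QuantumFieldTheory.Balaban1983to89.PBond (F.P (Summit.QuantumFields.YangMills.Theorems.K0RecordFormatNames.recordK₀ F Mc k + n)) 0) - Hr (⟨b.src, ν⟩ : Literature.MathematicalPhysics.QuantumFieldTheory.Balaban1983to89.PBond (F.P (Summit.QuantumFields.YangMills.Theorems.K0RecordFormatNames.recordK₀ F Mc k + n)) 0)) - (Hr (⟨b.src.unshift ν, b.dir⟩ : Literature.MathematicalPhysics.QuantumFieldTheory.Balaban1983to89.PBond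 (F.P (Summit.QuantumFields.YangMills.Theorems.K0RecordFormatNames.recordK₀ F Mc k + n)) 0) + Hr (⟨(b.src.unshift ν).shift b.dir, ν⟩ : Literature.MathematicalPhysics.QuantumFieldTheory.Balaban1983to89.PBond (F.P (Summit.QuantumFields.YangMills.Theorems.K0RecordFormatNames.recordK₀ F Mc k + n)) 0) - Hr (⟨(b.src.unshift ν).shift ν, b.dir⟩ : Literature.MathematicalPhysics.QuantumFieldTheory.Balaban1983to89.PBond (F.P (Summit.QuantumFields.YangMills.Theorems.K0RecordFormatNames.recordK₀ F Mc k + n)) 0) - Hr (⟨b.src.unshift ν, ν⟩ : Literature.MathematicalPhysics.QuantumFieldTheory.Balaban1983to89.PBond (F.P (Summit.QuantumFields.YangMills.Theorems.K0RecordFormatNames.recordK₀ F Mc k + n)) 0)))‖ ≤ C₉' * (F.P (Summit.QuantumFields.YangMills.Theorems.K0RecordFormatNames.recordK₀ F Mc k + n)).eta (k + 1) ^ 3 * Real.exp (-(δ₉ * (Literature.MathematicalPhysics.QuantumFieldTheory.Balaban1983to89.Site.tdist (Summit.QuantumFields.YangMills.Theorems.K0RecordFormatNames.coarsenTo (k +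 1) b.src) y : ℝ)))) → (∃ C₉' δ₉ : ℝ, 0 ≤ C₉' ∧ 0 < δ₉ ∧ ∀ (k n : ℕ) (ε₂₉ : ℝ), 0 < ε₂₉ → letI θ := Summit.QuantumFields.YangMills.Theorems.K0RecordFormatNames.thetaFill F a₀ ε₂₉; letI := θ.instVβ₁; letI := θ.instVβ₂; letI := θ.instιβ; ∀ (a : θ.ιβ) (μ : Fin (F.P (Summit.QuantumFields.YangMills.Theorems.K0RecordFormatNames.recordK₀ F Mc k + n)).d) (y : Literature.MathematicalPhysics.QuantumFieldTheory.Balaban1983to89.Site (F.P (Summit.QuantumFields.YangMills.Theorems.K0RecordFormatNames.recordK₀ F Mc k + n)) (k + 1)), letI D := fderiv ℝ (fun B : Summit.QuantumFields.YangMills.Theorems.K0RecordFormatNames.recordW F a₀ ε₂₉ k (Summit.QuantumFields.YangMills.Theorems.K0RecordFormatNames.recordK₀ F Mc k + n) => fun (b : Literature.MathematicalPhysics.QuantumFieldTheory.Balaban1983to89.PBond (F.P (Summit.QuantumFields.YangMills.Theorems.K0RecordFormatNames.recordK₀ F Mc k + n)) 0) (i i' : Fin 2) => ((Summit.QuantumFields.YangMills.Theorems.K0RecordFormatNames.recordBgField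 F θ k (Summit.QuantumFields.YangMills.Theorems.K0RecordFormatNames.recordK₀ F Mc k + n) B b : Literature.MathematicalPhysics.QuantumFieldTheory.Balaban1983to89.Node00.SU 2) : Matrix (Fin 2) (Fin 2) ℂ) i i') 0 (Pi.single μ (Pi.single y (θ.bV a))); ∃ (Hr : Literature.MathematicalPhysics.QuantumFieldTheory.Balaban1983to89.PBond (F.P (Summit.QuantumFields.YangMills.Theorems.K0RecordFormatNames.recordK₀ F Mc k + n)) 0 → Fin 2 → Fin 2 → ℂ) (φ : Literature.MathematicalPhysics.QuantumFieldTheory.Balaban1983to89.Site (F.P (Summit.QuantumFields.YangMills.Theorems.K0RecordFormatNames.recordK₀ F Mc k + n)) 0 → Fin 2 → Fin 2 → ℂ), (∀ b : Literature.MathematicalPhysics.QuantumFieldTheory.Balaban1983to89.PBond (F.P (Summit.QuantumFields.YangMills.Theorems.K0RecordFormatNames.recordK₀ F Mc k + n)) 0, D b = Hr b + (φ b.src - φ (b.src.shift b.dir))) ∧ (∃ μc : Literature.MathematicalPhysics.QuantumFieldTheory.Balaban1983to89.Site (F.P (Summit.QuantumFields.YangMills.Theorems.K0RecordFormatNames.recordK₀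 F Mc k + n)) (k + 1) → Fin 2 → Fin 2 → ℂ, ∀ x : Literature.MathematicalPhysics.QuantumFieldTheory.Balaban1983to89.Site (F.P (Summit.QuantumFields.YangMills.Theorems.K0RecordFormatNames.recordK₀ F Mc k + n)) 0, letI dv := (fun x' : Literature.MathematicalPhysics.QuantumFieldTheory.Balaban1983to89.Site (F.P (Summit.QuantumFields.YangMills.Theorems.K0RecordFormatNames.recordK₀ F Mc k + n)) 0 => ∑ ν : Fin (F.P (Summit.QuantumFields.YangMills.Theorems.K0RecordFormatNames.recordK₀ F Mc k + n)).d, (Hr ⟨x', ν⟩ - Hr ⟨x'.unshift ν, ν⟩)); ∑ ν : Fin (F.P (Summit.QuantumFields.YangMills.Theorems.K0RecordFormatNames.recordK₀ F Mc k + n)).d, (dv (x.shift ν) - (2 : ℂ) • dv x + dv (x.unshift ν)) = μc (Summit.QuantumFields.YangMills.Theorems.K0RecordFormatNames.coarsenTo (k + 1) x)) ∧ ∀ b : Literature.MathematicalPhysics.QuantumFieldTheory.Balaban1983to89.PBond (F.P (Summit.QuantumFields.YangMills.Theorems.K0RecordFormatNames.recordK₀ F Mc k + n)) 0, ‖Hr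 b‖ ≤ C₉' * (F.P (Summit.QuantumFields.YangMills.Theorems.K0RecordFormatNames.recordK₀ F Mc k + n)).eta (k + 1) * Real.exp (-(δ₉ * (Literature.MathematicalPhysics.QuantumFieldTheory.Balaban1983to89.Site.tdist (Summit.QuantumFields.YangMills.Theorems.K0RecordFormatNames.coarsenTo (k + 1) b.src) y : ℝ))) ∧ (∀ ν : Fin (F.P (Summit.QuantumFields.YangMills.Theorems.K0RecordFormatNames.recordK₀ F Mc k + n)).d, ‖Hr (⟨b.src.shift ν, b.dir⟩ : Literature.MathematicalPhysics.QuantumFieldTheory.Balaban1983to89.PBond (F.P (Summit.QuantumFields.YangMills.Theorems.K0RecordFormatNames.recordK₀ F Mc k + n)) 0) - Hr b‖ ≤ C₉' * (F.P (Summit.QuantumFields.YangMills.Theorems.K0RecordFormatNames.recordK₀ F Mc k + n)).eta (k + 1) ^ 2 * Real.exp (-(δ₉ * (Literature.MathematicalPhysics.QuantumFieldTheory.Balaban1983to89.Site.tdist (Summit.QuantumFields.YangMills.Theorems.K0RecordFormatNames.coarsenTo (k + 1) b.src) y : ℝ)))) ∧ ‖∑ ν : Fin (F.P (Summit.QuantumFields.YangMills.Theorems.K0RecordFormatNames.recordK₀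 F Mc k + n)).d, (Hr (⟨b.src.shift ν, b.dir⟩ : Literature.MathematicalPhysics.QuantumFieldTheory.Balaban1983to89.PBond (F.P (Summit.QuantumFields.YangMills.Theorems.K0RecordFormatNames.recordK₀ F Mc k + n)) 0) - (2 : ℂ) • Hr b + Hr (⟨b.src.unshift ν, b.dir⟩ : Literature.MathematicalPhysics.QuantumFieldTheory.Balaban1983to89.PBond (F.P (Summit.QuantumFields.YangMills.Theorems.K0RecordFormatNames.recordK₀ F Mc k + n)) 0))‖ ≤ C₉' * (F.P (Summit.QuantumFields.YangMills.Theorems.K0RecordFormatNames.recordK₀ F Mc k + n)).eta (k + 1) ^ 3 * Real.exp (-(δ₉ * (Literature.MathematicalPhysics.QuantumFieldTheory.Balaban1983to89.Site.tdist (Summit.QuantumFields.YangMills.Theorems.K0RecordFormatNames.coarsenTo (k + 1) b.src) y : ℝ))) ∧ ‖∑ ν : Fin (F.P (Summit.QuantumFields.YangMills.Theorems.K0RecordFormatNames.recordK₀ F Mc k + n)).d, ((Hr (⟨b.src, b.dir⟩ : Literature.MathematicalPhysics.QuantumFieldTheory.Balaban1983to89.PBond (F.P (Summit.QuantumFields.YangMills.Theorems.K0RecordFormatNames.recordK₀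 F Mc k + n)) 0) + Hr (⟨(b.src).shift b.dir, ν⟩ : Literature.MathematicalPhysics.QuantumFieldTheory.Balaban1983to89.PBond (F.P (Summit.QuantumFields.YangMills.Theorems.K0RecordFormatNames.recordK₀ F Mc k + n)) 0) - Hr (⟨(b.src).shift ν, b.dir⟩ : Literature.MathematicalPhysics.QuantumFieldTheory.Balaban1983to89.PBond (F.P (Summit.QuantumFields.YangMills.Theorems.K0RecordFormatNames.recordK₀ F Mc k + n)) 0) - Hr (⟨b.src, ν⟩ : Literature.MathematicalPhysics.QuantumFieldTheory.Balaban1983to89.PBond (F.P (Summit.QuantumFields.YangMills.Theorems.K0RecordFormatNames.recordK₀ F Mc k + n)) 0)) - (Hr (⟨b.src.unshift ν, b.dir⟩ : Literature.MathematicalPhysics.QuantumFieldTheory.Balaban1983to89.PBond (F.P (Summit.QuantumFields.YangMills.Theorems.K0RecordFormatNames.recordK₀ F Mc k + n)) 0) + Hr (⟨(b.src.unshift ν).shift b.dir, ν⟩ : Literature.MathematicalPhysics.QuantumFieldTheory.Balaban1983to89.PBond (F.P (Summit.QuantumFields.YangMills.Theorems.K0RecordFormatNames.recordK₀ F Mc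 k + n)) 0) - Hr (⟨(b.src.unshift ν).shift ν, b.dir⟩ : Literature.MathematicalPhysics.QuantumFieldTheory.Balaban1983to89.PBond (F.P (Summit.QuantumFields.YangMills.Theorems.K0RecordFormatNames.recordK₀ F Mc k + n)) 0) - Hr (⟨b.src.unshift ν, ν⟩ : Literature.MathematicalPhysics.QuantumFieldTheory.Balaban1983to89.PBond (F.P (Summit.QuantumFields.YangMills.Theorems.K0RecordFormatNames.recordK₀ F Mc k + n)) 0)))‖ ≤ C₉' * (F.P (Summit.QuantumFields.YangMills.Theorems.K0RecordFormatNames.recordK₀ F Mc k + n)).eta (k + 1) ^ 3 * Real.exp (-(δ₉ * (Literature.MathematicalPhysics.QuantumFieldTheory.Balaban1983to89.Site.tdist (Summit.QuantumFields.YangMills.Theorems.K0RecordFormatNames.coarsenTo (k + 1) b.src) y : ℝ)))) := by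
  rintro ⟨C₉', δ₉, hC, hδ, h⟩
  exact ⟨C₉', δ₉, hC, hδ, fun k n ε₂₉ hε a μ y => tokP9L4_old_of_new_at F Mc a₀ ε₂₉ C₉' δ₉ k n a μ y (h k n ε₂₉ hε a μ y)⟩

end Bridge

end Summit.QuantumFields.YangMills.Theorems.PortU8

end
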